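import Summits.QuantumFields.YangMills.Theorems.BalabanUVNodesN15KingModelNE2

/-!
# Route «BalabanUVNodes» (K3⁷), node N15 = NE2 — THE KING-MODEL RUNG, part 48: KING'S LEMMA 4.5 (4.38) AT THE RATE `L^{−2(1−σ)k}`
# FOR EVERY `σ ∈ (0,1]` — interpolation in place of the geometric mean; for `σ ≥ ¼` at King's OWN decay rate `δ₄₅` (headline `L^{−3k/2}`)

Cell `pub-ymgap`, Track A (D-0062), seat `pub-ymgap-dag-n15-d` (R134 row s3 «King 1986 Lemma 4.5 (4.38) as the scalar kernel»; HUMAN RULING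
D-0149 T⁴ apex work-bound push, director-ym LINE №197).  `bears_on: R4∕N15`; `--supports stmt-QuantumFields-20544` (K3⁷), helper.  COUNT-NEUTRAL.

THE PRINT.  [King1986] = C. King, *The U(1) Higgs model. I*, CMP **102** (1986) 649–677, Lemma 4.5 (4.38) p.674 *«|C^{(k)}(x,y) − C^{(k+n)}(x,y)|
≤ CL^{−k}e^{−δ₀|x−y|}»*, proof p.675 *«Combining Lemma 4.3 and the uniform exponential decay of Δ^{(k)} and C_Ω^{(k)}(s) gives |(4.40)| ≤ CL^{−k} …
(4.41)»*; Lemma 4.3 (4.18) p.672 gives the LEVELS at the rate `L^{−2k}`: *«|Δ^{(k)}(p′) − Δ^{(k+n)}(p′)| ≤ CL^{−2k}Δ^{(k)}(p′)»*.  In the tree, for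
King's ACTUAL A = 0 operators on every torus: `King1986.Torus.king_lemma45_torus` (rate `K₄₅·L^{−k}`, decay `δ₄₅`), assembled from the sup-rate of the
kernel of `Δ^{(k+n)} − Δ^{(k)}` (`effLaplacian_sub_apply_le`: `≤ θ_k·a`, `θ_k ≤ θ̄·L^{−2k}`, `thetaK_le`), the uniform decay of each level
(`effLaplacian_entry_le_unif`: `≤ C_U e^{−κ_U|z−w|_T}`) and the engine `CovarianceRate.lemma45`; the exponent `L^{−k} = √(L^{−2k})` enters at exactly
one place, the GEOMETRIC MEAN `CovarianceRate.abs_le_sqrt_mul_exp_half` (`min(ε, Ae^{−δt}) ≤ √(εA)·e^{−(δ/2)t}`) inside `sub_kernel_rate`.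

WHAT THIS FILE PROVES (0 sorry).  Replacing the square root by the interpolation `min(ε, Ae^{−δt}) ≤ ε^{1−σ}A^{σ}e^{−σδt}` (`σ ∈ [0,1]`) and running
the SAME engine gives, for King's actual covariances `C^{(k)} = (Δ^{(k)} + aL⁻²Q*Q)⁻¹ on every torus `Π_μ ℤ∕(LM_μ)`: §1 `abs_le_rpow_interp_mul_exp`,
`sub_kernel_rate_rpow` (sup-rate `ε` + levelwise decay `C₁e^{−κ₁d}` ⇒ `≤ ε^{1−σ}(2C₁)^{σ}e^{−σκ₁d}`); §3 constants `kapSig = min κ′ (σκ_U)` (Combes–Thomas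
rate), `delta45Sig = kapSig∕2`, `thetaSig L σ = (L⁻²)^{1−σ} = L^{−2(1−σ)}` (`thetaSig_eq_rpow`, `0 < θ_σ`, `θ_σ < 1` for `σ < 1`), `K45Sig`, and
★★ **`king_lemma45_torus_sigma`**: for `L ≥ 2`, `k, n ≥ 1`, `a, m² > 0`, `0 < σ ≤ 1`, every torus and all `x, y`,
`|C^{(k)}(x,y) − C^{(k+n)}(x,y)| ≤ K₄₅(σ)·θ_σ^k·e^{−δ₄₅(σ)|x−y|_T}`, constants depending on `(a, L, d, σ)` only; `kapSig_eq_kapCT` (for `σ ≥ ¼` the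
Combes–Thomas rate IS King's `κ′ ≤ κ_U∕4`), ★ **`king_lemma45_torus_sigma_sameRate`** (σ ∈ [¼,1]: decay at the tree's OWN `δ₄₅`), headline
★ `king_lemma45_torus_threeHalves` (σ = ¼: rate `(L^{−3/2})^k` AT `δ₄₅` — strictly sharper than the printed `L^{−k}` at no cost in decay); §4 by name
★ `etaRateIneqUnit_king_sigma` (`T4EtaRate.EtaRateIneqUnit` for King's kernel with `(B₀, δ₀, θ) = (K₄₅(σ)+1, δ₄₅(σ), θ_σ)`),
`etaRateIneqUnit_king_threeHalves`.  (`NE2PlusUnit` hides `θ` behind `∃`: part 5's `ne2PlusUnit_king` is unchanged, its witness may be `L^{−2(1−σ)}`.)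

HONEST SCOPE ∕ LIMITS.  King's A = 0 SCALAR model, periodic b.c., flat blocks, `k ≥ 1` — as `king_lemma45_torus`.  A REMARK-sized sharpening of the
EXPONENT of a printed, proved lemma from the tree's own ingredients; NOT printed by King in this form.  The SHARP rate `η² = L^{−2k}` at FIXED decay
(σ → 0 sends `δ₄₅(σ) → 0`) needs the levels' difference kernel with rate AND decay at once (momentum-space analyticity, p.675) — NOT claimed.  NE2 consumes
any geometric rate: count-neutral, N15 NOT discharged, nothing continuum ∕ OS ∕ mass-gap ∕ Clay.  Locators: [King1986] (4.18) p.672, (4.32)–(4.41) pp.674–675.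
-/

noncomputable section

open scoped BigOperators
open Finset

namespace Summit.QuantumFields.YangMills.BalabanUVNodes.N15.KingModel

open Literature.MathematicalPhysics.QuantumFieldTheory.Balaban1983to89
open Literature.MathematicalPhysics.QuantumFieldTheory.Balaban1983to89.QGQInverse (Coercive)
open Literature.MathematicalPhysics.QuantumFieldTheory.Balaban1983to89.B4Sect5Torus
open Literature.MathematicalPhysics.QuantumFieldTheory.Balaban1983to89.B5Prop11Plancherel (Tor fine)
open Literature.MathematicalPhysics.QuantumFieldTheory.Balaban1983to89.T4EtaRate (EtaRateIneqUnit)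
open Literature.MathematicalPhysics.QuantumFieldTheory.King1986
open Literature.MathematicalPhysics.QuantumFieldTheory.King1986.Torus

/-! ## §1 Interpolation in place of the geometric mean -/

section Interp

/-- **`min ≤ weighted geometric mean`**: a quantity bounded BOTH by `ε` AND by a decaying majorant `Ae^{−δt}` is bounded by
`ε^{1−σ}A^{σ}e^{−σδt}` for every `σ ∈ [0,1]` (`σ = ½` is `CovarianceRate.abs_le_sqrt_mul_exp_half`). [folklore] -/
theorem abs_le_rpow_interp_mul_exp {e ε A δ t σ : ℝ} (hσ0 : 0 ≤ σ) (hσ1 : σ ≤ 1) (h1 : |e| ≤ ε)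
    (h2 : |e| ≤ A * Real.exp (-(δ * t))) :
    |e| ≤ ε ^ (1 - σ) * A ^ σ * Real.exp (-(σ * δ * t)) := by
  have he : 0 ≤ |e| := abs_nonneg e
  have hε : 0 ≤ ε := he.trans h1
  have hpos := Real.exp_pos (-(δ * t))
  have hA : 0 ≤ A := by
    have h0 : 0 * Real.exp (-(δ * t)) ≤ A * Real.exp (-(δ * t)) := by rw [zero_mul]; exact he.trans h2
    exact le_of_mul_le_mul_right h0 hpos
  have hsplit : |e| ^ (1 - σ) * |e| ^ σ = |e| := by
    rw [← Real.rpow_add' he (by rw [sub_add_cancel]; exact one_ne_zero), sub_add_cancel, Real.rpow_one]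
  have hl : |e| ^ (1 - σ) ≤ ε ^ (1 - σ) := Real.rpow_le_rpow he h1 (sub_nonneg.mpr hσ1)
  have hr : |e| ^ σ ≤ A ^ σ * Real.exp (-(σ * δ * t)) := by
    calc |e| ^ σ ≤ (A * Real.exp (-(δ * t))) ^ σ := Real.rpow_le_rpow he h2 hσ0
      _ = A ^ σ * Real.exp (-(δ * t)) ^ σ := Real.mul_rpow hA hpos.le
      _ = A ^ σ * Real.exp (-(σ * δ * t)) := by
          rw [← Real.exp_mul]; ring_nf
  calc |e| = |e| ^ (1 - σ) * |e| ^ σ := hsplit.symm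
    _ ≤ ε ^ (1 - σ) * (A ^ σ * Real.exp (-(σ * δ * t))) :=
        mul_le_mul hl hr (Real.rpow_nonneg he σ) (Real.rpow_nonneg hε _)
    _ = ε ^ (1 - σ) * A ^ σ * Real.exp (-(σ * δ * t)) := by ring

/-- **The rate input of `CovarianceRate.lemma45`, interpolated**: a sup-norm rate `ε` for the kernel of `Δ^{(k+n)} − Δ^{(k)}` and the decay
`C₁e^{−κ₁d}` of each of `Δ^{(k)}`, `Δ^{(k+n)}` give `|Δ^{(k+n)}(z,w) − Δ^{(k)}(z,w)| ≤ ε^{1−σ}(2C₁)^{σ}e^{−σκ₁d(z,w)}` for every `σ ∈ [0,1]`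
(`σ = ½`: `CovarianceRate.sub_kernel_rate`). [folklore] -/
theorem sub_kernel_rate_rpow {n : Type*} (Δ₁ Δ₀ : Matrix n n ℝ) (d : n → n → ℝ) {ε C₁ κ₁ σ : ℝ}
    (hσ0 : 0 ≤ σ) (hσ1 : σ ≤ 1)
    (hEsup : ∀ z w, |(Δ₀ - Δ₁) z w| ≤ ε)
    (hD1 : ∀ z w, |Δ₁ z w| ≤ C₁ * Real.exp (-(κ₁ * d z w)))
    (hD0 : ∀ z w, |Δ₀ z w| ≤ C₁ * Real.exp (-(κ₁ * d z w))) (z w : n) :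
    |(Δ₀ - Δ₁) z w| ≤ ε ^ (1 - σ) * (2 * C₁) ^ σ * Real.exp (-(σ * κ₁ * d z w)) := by
  have hdec : |(Δ₀ - Δ₁) z w| ≤ (2 * C₁) * Real.exp (-(κ₁ * d z w)) := by
    rw [Matrix.sub_apply]
    calc |Δ₀ z w - Δ₁ z w| ≤ |Δ₀ z w| + |Δ₁ z w| := abs_sub _ _
      _ ≤ C₁ * Real.exp (-(κ₁ * d z w)) + C₁ * Real.exp (-(κ₁ * d z w)) := add_le_add (hD0 z w) (hD1 z w)
      _ = (2 * C₁) * Real.exp (-(κ₁ * d z w)) := by ring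
  exact abs_le_rpow_interp_mul_exp hσ0 hσ1 (hEsup z w) hdec

end Interp

/-! ## §3 King's Lemma 4.5 on every torus at the interpolated rate -/

section Torus

variable (d : ℕ)

/-- The interpolated Combes–Thomas rate `κ_σ = min κ′ (σκ_U)` (`κ′ = kapCT`, `κ_U = kapU` at `a_min`). [folklore] -/
def kapSig (a : ℝ) (L : ℕ) (σ : ℝ) : ℝ := min (kapCT d a L) (σ * kapU d a (aminL a L))

/-- The decay rate `δ₄₅(σ) = κ_σ∕2`. [folklore] -/
def delta45Sig (a : ℝ) (L : ℕ) (σ : ℝ) : ℝ := kapSig d a L σ / 2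

/-- The constant `K₄₅(σ) = (θ̄a)^{1−σ}(2C_U)^{σ}·(2∕γ₀)²·K_d(κ_σ∕2)²`. [folklore] -/
def K45Sig (a : ℝ) (L : ℕ) (σ : ℝ) : ℝ :=
  (thetaBar a L * a) ^ (1 - σ) * (2 * CDelU d a (aminL a L)) ^ σ * (2 / gam0L d a L) ^ 2
    * B4Sect5Proof.latticeConst d (kapSig d a L σ / 2) ^ 2

variable {d}

/-- The rate per level `θ_σ = (L⁻²)^{1−σ} = L^{−2(1−σ)}`. [folklore] -/
def thetaSig (L : ℕ) (σ : ℝ) : ℝ := (((L : ℝ) ^ 2)⁻¹) ^ (1 - σ)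

/-- `θ_σ = L^{−2(1−σ)}` as a real power. [folklore] -/
theorem thetaSig_eq_rpow (L : ℕ) (σ : ℝ) : thetaSig L σ = (L : ℝ) ^ (-(2 * (1 - σ))) := by
  unfold thetaSig
  have hL : (0 : ℝ) ≤ L := Nat.cast_nonneg L
  rw [Real.rpow_neg hL, Real.inv_rpow (pow_nonneg hL 2), Real.rpow_mul hL]
  norm_num

/-- `θ_{1/4} = L^{−3/2}`. [folklore] -/
theorem thetaSig_quarter (L : ℕ) : thetaSig L (1 / 4) = (L : ℝ) ^ (-(3 / 2 : ℝ)) := by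
  rw [thetaSig_eq_rpow]; norm_num

/-- `0 < θ_σ` (for `L ≥ 1`). [folklore] -/
theorem thetaSig_pos {L : ℕ} (hL : 1 ≤ L) (σ : ℝ) : 0 < thetaSig L σ := by
  unfold thetaSig
  have : (0 : ℝ) < L := by exact_mod_cast hL
  positivity

/-- `θ_σ < 1` for `L ≥ 2` and `σ < 1` (a genuine rate). [folklore] -/
theorem thetaSig_lt_one {L : ℕ} (hL : 2 ≤ L) {σ : ℝ} (hσ : σ < 1) : thetaSig L σ < 1 := by
  unfold thetaSig
  have hLr : (1 : ℝ) < L := by exact_mod_cast hL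
  have h1 : (1 : ℝ) < (L : ℝ) ^ 2 := by nlinarith
  exact Real.rpow_lt_one (by positivity) (inv_lt_one_of_one_lt₀ h1) (by linarith)

/-- The level factor: `((L^k)²)⁻¹` raised to `1−σ` is `θ_σ^k`. [folklore] -/
theorem inv_sq_pow_rpow_eq (L k : ℕ) (σ : ℝ) : ((((L : ℝ) ^ k) ^ 2)⁻¹) ^ (1 - σ) = thetaSig L σ ^ k := by
  unfold thetaSig
  have hL : (0 : ℝ) ≤ ((L : ℝ) ^ 2)⁻¹ := by positivity
  have e : (((L : ℝ) ^ k) ^ 2)⁻¹ = (((L : ℝ) ^ 2)⁻¹) ^ k := by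
    rw [inv_pow, ← pow_mul, ← pow_mul, Nat.mul_comm]
  rw [e, ← Real.rpow_natCast (((L : ℝ) ^ 2)⁻¹) k, ← Real.rpow_mul hL, mul_comm (k : ℝ) (1 - σ),
    Real.rpow_mul hL, Real.rpow_natCast]

/-- `0 < κ_σ` for `σ > 0`. [folklore] -/
theorem kapSig_pos {a : ℝ} (ha : 0 < a) {L : ℕ} (hL : 2 ≤ L) {σ : ℝ} (hσ : 0 < σ) : 0 < kapSig d a L σ := by
  unfold kapSig
  have h1 := (kapCT_pos_le (d := d) ha hL).1
  have h2 := (kapU_pos_le (d := d) ha (aminL_pos ha hL)).1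
  exact lt_min h1 (mul_pos hσ h2)

/-- `κ_σ ≤ κ′`. [folklore] -/
theorem kapSig_le_kapCT (a : ℝ) (L : ℕ) (σ : ℝ) : kapSig d a L σ ≤ kapCT d a L := min_le_left _ _
/-- `κ_σ ≤ σκ_U`. [folklore] -/
theorem kapSig_le_sigma_mul (a : ℝ) (L : ℕ) (σ : ℝ) : kapSig d a L σ ≤ σ * kapU d a (aminL a L) := min_le_right _ _

/-- For `σ ≥ ¼` the interpolated Combes–Thomas rate IS King's `κ′` (because `κ′ ≤ κ_U∕4`). [folklore] -/
theorem kapSig_eq_kapCT {a : ℝ} (ha : 0 < a) {L : ℕ} (hL : 2 ≤ L) {σ : ℝ} (hσ : 1 / 4 ≤ σ) :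
    kapSig d a L σ = kapCT d a L := by
  unfold kapSig
  refine min_eq_left ?_
  have h1 := (kapCT_pos_le (d := d) ha hL).2
  have h2 := (kapU_pos_le (d := d) ha (aminL_pos ha hL)).1
  exact h1.trans (by nlinarith [mul_le_mul_of_nonneg_right hσ h2.le])

/-- `δ₄₅(σ) > 0` for `σ > 0`. [folklore] -/
theorem delta45Sig_pos {a : ℝ} (ha : 0 < a) {L : ℕ} (hL : 2 ≤ L) {σ : ℝ} (hσ : 0 < σ) : 0 < delta45Sig d a L σ := by
  unfold delta45Sig; have := kapSig_pos (d := d) ha hL hσ; positivity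

/-- For `σ ≥ ¼`, `δ₄₅(σ) = δ₄₅`. [folklore] -/
theorem delta45Sig_eq_delta45 {a : ℝ} (ha : 0 < a) {L : ℕ} (hL : 2 ≤ L) {σ : ℝ} (hσ : 1 / 4 ≤ σ) :
    delta45Sig d a L σ = delta45 d a L := by
  unfold delta45Sig delta45; rw [kapSig_eq_kapCT ha hL hσ]

/-- `K₄₅(σ) ≥ 0`. [folklore] -/
theorem K45Sig_nonneg {a : ℝ} (ha : 0 < a) {L : ℕ} (hL : 2 ≤ L) (σ : ℝ) : 0 ≤ K45Sig d a L σ := by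
  unfold K45Sig
  have hamin := aminL_pos ha hL
  have h1 : 0 ≤ thetaBar a L * a := by
    unfold thetaBar; have := (inv_pos.mpr hamin).le; positivity
  have h2 : 0 ≤ 2 * CDelU d a (aminL a L) := by have := CDelU_pos (d := d) ha hamin; positivity
  have h3 : 0 ≤ (thetaBar a L * a) ^ (1 - σ) := Real.rpow_nonneg h1 _
  have h4 : 0 ≤ (2 * CDelU d a (aminL a L)) ^ σ := Real.rpow_nonneg h2 _
  positivity

/-- **KING'S LEMMA 4.5 (4.38) ON EVERY TORUS AT THE RATE `L^{−2(1−σ)k}`, FOR EVERY `σ ∈ (0,1]`, NO HYPOTHESIS LEFT.**  Let `L ≥ 2`, `k, n ≥ 1`,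
`a > 0`, `m² > 0`, `0 < σ ≤ 1`, `Ω = Π_μ ℤ∕(L·M_μ)` any torus, `Δ^{(k)}`, `Δ^{(k+n)}` King's effective Laplacians (2.14)∕(4.5) (`N₁ = L^k`, `a_k`;
`N₀ = L^{k+n}`, `a_{k+n}`) and `C^{(·)} = (Δ^{(·)} + aL⁻²Q*Q)⁻¹` the unit-lattice fluctuation covariances (4.32).  Then for all `x, y ∈ Ω`
`|C^{(k)}(x,y) − C^{(k+n)}(x,y)| ≤ K₄₅(σ)·θ_σ^k·e^{−δ₄₅(σ)|x−y|_T}`, `θ_σ = L^{−2(1−σ)}`, with `K₄₅(σ) ≥ 0`, `δ₄₅(σ) > 0` depending on `(a, L, d, σ)` ONLY.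
PROOF = that of `king_lemma45_torus` with Combes–Thomas rate `κ_σ = min κ′ (σκ_U)` and `sub_kernel_rate_rpow` (levels' sup-rate `θ_k·a ≤ θ̄a·L^{−2k}` =
Lemma 4.3, decay `C_Ue^{−κ_U d}` = Thm 3.3 ∕ Dimock) in place of the geometric mean, into the unchanged engine `CovarianceRate.lemma45`.  HONEST SCOPE:
A = 0 scalar model, periodic b.c.; a sharpening of the printed EXPONENT (`σ = ½` is the printed `L^{−k}`), not printed in this form; the sharp `L^{−2k}` at
fixed decay is NOT claimed. [cite: King1986, Lemma 4.5 (4.38) p.674, proof (4.39)–(4.41) p.675, Lemma 4.3 (4.18) p.672, (4.32)–(4.34) p.674] -/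
theorem king_lemma45_torus_sigma {a m2 σ : ℝ} (ha : 0 < a) (hm : 0 < m2) (hσ0 : 0 < σ) (hσ1 : σ ≤ 1)
    {L k n : ℕ} [NeZero L] (hL : 2 ≤ L) (hk : 1 ≤ k) (hn : 1 ≤ n) (M : Fin d → ℕ) [∀ μ, NeZero (M μ)]
    (x y : Tor (fine L M)) :
    |(effLaplacian (L ^ k) (fine L M) (aK a L k) (((L ^ k : ℕ) : ℝ) ^ 2) m2
          + (a * ((L : ℝ) ^ 2)⁻¹) • blockProj L M)⁻¹ x y
      - (effLaplacian (L ^ n * L ^ k) (fine L M) (aK a L (k + n)) (((L ^ n * L ^ k : ℕ) : ℝ) ^ 2) m2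
          + (a * ((L : ℝ) ^ 2)⁻¹) • blockProj L M)⁻¹ x y|
      ≤ K45Sig d a L σ * thetaSig L σ ^ k * Real.exp (-(delta45Sig d a L σ * tdistT (fine L M) x y)) := by
  set Δ₁ := effLaplacian (L ^ k) (fine L M) (aK a L k) (((L ^ k : ℕ) : ℝ) ^ 2) m2 with hΔ₁
  set Δ₀ := effLaplacian (L ^ n * L ^ k) (fine L M) (aK a L (k + n)) (((L ^ n * L ^ k : ℕ) : ℝ) ^ 2) m2
    with hΔ₀
  set B : Matrix (Tor (fine L M)) (Tor (fine L M)) ℝ := (a * ((L : ℝ) ^ 2)⁻¹) • blockProj L M with hB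
  set ρd := tdistT (fine L M) with hρd
  set amin := aminL a L with hamin_def
  set γ₀ := gam0L d a L with hγ₀
  set κU := kapU d a amin with hκU
  set CU := CDelU d a amin with hCU
  set cb := cB d a L with hcb
  set κ' := kapCT d a L with hκ'
  set κs := kapSig d a L σ with hκs
  set Kd := B4Sect5Proof.latticeConst d with hKd
  -- positivity of the data
  have hL1 : 1 ≤ L := by omega
  have hamin : 0 < amin := aminL_pos ha hL
  obtain ⟨hak1, hak2⟩ := aminL_le_aK ha hL hk
  obtain ⟨hakn1, hakn2⟩ := aminL_le_aK ha hL (show 1 ≤ k + n by omega)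
  have hγ₀pos : 0 < γ₀ := gam0L_pos ha hL
  obtain ⟨hκU0, hκU1⟩ := kapU_pos_le (d := d) ha hamin
  have hCU0 : 0 < CU := CDelU_pos ha hamin
  have hcb0 : 0 ≤ cb := cB_nonneg ha.le L
  obtain ⟨hκ'0, hκ'le⟩ := kapCT_pos_le (d := d) ha hL
  have hκ'U : κ' ≤ κU / 4 := hκ'le
  have hκs0 : 0 < κs := kapSig_pos (d := d) ha hL hσ0
  have hκsκ' : κs ≤ κ' := kapSig_le_kapCT (d := d) a L σ
  have hκsU : κs ≤ κU / 4 := hκsκ'.trans hκ'U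
  have hκsσ : κs ≤ σ * κU := kapSig_le_sigma_mul (d := d) a L σ
  have hKd : ∀ t : ℝ, 0 < t → 0 ≤ Kd t := latticeConst_profile_nonneg d
  -- (a) endpoint coercivity (4.33): king433
  have h433 := king433 L M hL1 hamin ha hak1 hakn1 (L ^ k) (L ^ n * L ^ k) hm hm
  have h1 : Coercive (Δ₁ + B) γ₀ := h433.1
  have h0 : Coercive (Δ₀ + B) γ₀ := h433.2
  -- (b) pointwise decay (4.34)
  have hD1 : ∀ z w, |Δ₁ z w| ≤ CU * Real.exp (-(κU * ρd z w)) := fun z w =>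
    effLaplacian_entry_le_unif ha hamin hak1 hak2 hm (L ^ k) (fine L M) z w
  have hD0 : ∀ z w, |Δ₀ z w| ≤ CU * Real.exp (-(κU * ρd z w)) := fun z w =>
    effLaplacian_entry_le_unif ha hamin hakn1 hakn2 hm (L ^ n * L ^ k) (fine L M) z w
  have hDB : ∀ z w, |B z w| ≤ cb * Real.exp (-(κU * ρd z w)) := fun z w =>
    blockTerm_entry_le L M ha.le hκU0.le z w
  -- pseudo-distance and lattice sums
  have hpd : IsPseudoDist ρd := tdistT_isPseudoDist (fine L M)
  have hSB : SumBound ρd Kd := tdistT_sumBound (fine L M)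
  -- weighted sums (Combes–Thomas inputs) at the rate κ_σ ≤ κ′ ≤ κ_U/4
  have hr1 : ∀ i, wRow Δ₁ ρd κs i ≤ κs * weightC Kd CU κU := fun i =>
    weightedRowSum_le hpd.nonneg hSB Δ₁ hCU0.le hκU0 hκs0.le hκsU hD1 i
  have hr0 : ∀ i, wRow Δ₀ ρd κs i ≤ κs * weightC Kd CU κU := fun i =>
    weightedRowSum_le hpd.nonneg hSB Δ₀ hCU0.le hκU0 hκs0.le hκsU hD0 i
  have hrB : ∀ i, wRow B ρd κs i ≤ κs * weightC Kd cb κU := fun i =>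
    weightedRowSum_le hpd.nonneg hSB B hcb0 hκU0 hκs0.le hκsU hDB i
  have hc1 : ∀ j, wCol Δ₁ ρd κs j ≤ κs * weightC Kd CU κU := fun j =>
    weightedColSum_le hpd hSB Δ₁ hCU0.le hκU0 hκs0.le hκsU hD1 j
  have hc0 : ∀ j, wCol Δ₀ ρd κs j ≤ κs * weightC Kd CU κU := fun j =>
    weightedColSum_le hpd hSB Δ₀ hCU0.le hκU0 hκs0.le hκsU hD0 j
  have hcB : ∀ j, wCol B ρd κs j ≤ κs * weightC Kd cb κU := fun j =>
    weightedColSum_le hpd hSB B hcb0 hκU0 hκs0.le hκsU hDB j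
  -- ρ + ρ_B ≤ γ₀/2 < γ₀ (monotone in the rate: κ_σ ≤ κ′)
  have hsum : κs * weightC Kd CU κU + κs * weightC Kd cb κU ≤ γ₀ / 2 := by
    have hW : 0 ≤ weightC Kd (CU + cb) κU := weightC_nonneg hKd (add_nonneg hCU0.le hcb0) hκU0
    have hlin : κs * weightC Kd CU κU + κs * weightC Kd cb κU = κs * weightC Kd (CU + cb) κU := by
      unfold weightC; ring
    rw [hlin]
    calc κs * weightC Kd (CU + cb) κU ≤ κ' * weightC Kd (CU + cb) κU := mul_le_mul_of_nonneg_right hκsκ' hW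
      _ ≤ γ₀ / 2 := rate_mul_weightC_le hKd hγ₀pos (add_nonneg hCU0.le hcb0) hκU0
  have hγ : κs * weightC Kd CU κU + κs * weightC Kd cb κU < γ₀ := by linarith
  -- (c) the rate: sup-norm of the kernel of Δ₀ − Δ₁, interpolated against the levels' decay
  have hak0 : 0 < aK a L k := lt_of_lt_of_le hamin hak1
  have han0 : 0 < aK a L n := lt_of_lt_of_le hamin (aminL_le_aK ha hL hn).1
  have hε0 : 0 ≤ thetaK a L k n * a := by unfold thetaK; positivity
  have hEsup : ∀ z w, |(Δ₀ - Δ₁) z w| ≤ thetaK a L k n * a := fun z w => by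
    rw [Matrix.sub_apply]
    exact effLaplacian_sub_apply_le ha hm hL hk hn M z w
  set θ : ℝ := (thetaK a L k n * a) ^ (1 - σ) * (2 * CU) ^ σ with hθ_def
  have hθ0 : 0 ≤ θ := mul_nonneg (Real.rpow_nonneg hε0 _) (Real.rpow_nonneg (by positivity) _)
  have hE : ∀ z w, |(Δ₀ - Δ₁) z w| ≤ θ * Real.exp (-(κs * ρd z w)) := fun z w => by
    have h := sub_kernel_rate_rpow Δ₁ Δ₀ ρd hσ0.le hσ1 hEsup hD1 hD0 z w
    refine h.trans ?_
    exact exp_decay_mono hθ0 hκsσ (hpd.nonneg z w)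
  -- (d) the lattice sums at rate κ_σ/2
  have hV : ∀ z, ∑ w, Real.exp (-(κs / 2 * ρd z w)) ≤ Kd (κs / 2) := fun z => hSB (κs / 2) (by positivity) z
  -- LEMMA 4.5 (abstract engine)
  have h45 := lemma45 Δ₁ Δ₀ B ρd hγ hκs0.le hθ0 h1 h0 hpd.symm hpd.zero hpd.triangle
    hr1 hr0 hrB hc1 hc0 hcB hE hV x y
  refine h45.trans ?_
  -- constants: θ ≤ (θ̄a)^{1−σ}(2C_U)^σ·θ_σ^k, (γ₀ − ρ − ρ_B)⁻¹ ≤ 2/γ₀, V = K_d(κ_σ/2)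
  have hθbar0 : 0 ≤ thetaBar a L * a := by
    unfold thetaBar; have := (inv_pos.mpr hamin).le; positivity
  have hθle : θ ≤ (thetaBar a L * a) ^ (1 - σ) * (2 * CU) ^ σ * thetaSig L σ ^ k := by
    have hK : thetaK a L k n * a ≤ thetaBar a L * a * (((L : ℝ) ^ k) ^ 2)⁻¹ := by
      have := thetaK_le ha hL hk hn
      calc thetaK a L k n * a ≤ thetaBar a L * (((L : ℝ) ^ k) ^ 2)⁻¹ * a := mul_le_mul_of_nonneg_right this ha.le
        _ = thetaBar a L * a * (((L : ℝ) ^ k) ^ 2)⁻¹ := by ring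
    have hpow : (thetaK a L k n * a) ^ (1 - σ)
        ≤ (thetaBar a L * a) ^ (1 - σ) * thetaSig L σ ^ k := by
      calc (thetaK a L k n * a) ^ (1 - σ) ≤ (thetaBar a L * a * (((L : ℝ) ^ k) ^ 2)⁻¹) ^ (1 - σ) :=
            Real.rpow_le_rpow hε0 hK (sub_nonneg.mpr hσ1)
        _ = (thetaBar a L * a) ^ (1 - σ) * ((((L : ℝ) ^ k) ^ 2)⁻¹) ^ (1 - σ) := Real.mul_rpow hθbar0 (by positivity)
        _ = (thetaBar a L * a) ^ (1 - σ) * thetaSig L σ ^ k := by rw [inv_sq_pow_rpow_eq]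
    have h2CU : 0 ≤ (2 * CU) ^ σ := Real.rpow_nonneg (by positivity) _
    calc θ = (thetaK a L k n * a) ^ (1 - σ) * (2 * CU) ^ σ := rfl
      _ ≤ ((thetaBar a L * a) ^ (1 - σ) * thetaSig L σ ^ k) * (2 * CU) ^ σ := mul_le_mul_of_nonneg_right hpow h2CU
      _ = _ := by ring
  have hinv : (γ₀ - (κs * weightC Kd CU κU + κs * weightC Kd cb κU))⁻¹ ≤ 2 / γ₀ := by
    rw [div_eq_mul_inv, show (2 : ℝ) * γ₀⁻¹ = (γ₀ / 2)⁻¹ by rw [inv_div]; ring]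
    exact inv_anti₀ (by positivity) (by linarith)
  have hinv0 : 0 ≤ (γ₀ - (κs * weightC Kd CU κU + κs * weightC Kd cb κU))⁻¹ := inv_nonneg.mpr (by linarith)
  have hVnn : 0 ≤ Kd (κs / 2) := hKd _ (by positivity)
  have hθσ0 : 0 ≤ thetaSig L σ ^ k := pow_nonneg (thetaSig_pos hL1 σ).le k
  have hT0 : 0 ≤ (thetaBar a L * a) ^ (1 - σ) * (2 * CU) ^ σ :=
    mul_nonneg (Real.rpow_nonneg hθbar0 _) (Real.rpow_nonneg (by positivity) _)
  have e45 : K45Sig d a L σ * thetaSig L σ ^ k * Real.exp (-(delta45Sig d a L σ * tdistT (fine L M) x y))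
      = ((thetaBar a L * a) ^ (1 - σ) * (2 * CU) ^ σ * thetaSig L σ ^ k) * (2 / γ₀) ^ 2 * Kd (κs / 2) ^ 2
        * Real.exp (-(κs / 2 * ρd x y)) := by
    simp only [K45Sig, delta45Sig, hCU, hκs, hγ₀, hρd, hamin_def]
    ring
  rw [e45]
  gcongr

/-- **FOR `σ ∈ [¼, 1]` THE DECAY RATE IS KING'S OWN `δ₄₅`**: `|C^{(k)}(x,y) − C^{(k+n)}(x,y)| ≤ K₄₅(σ)·θ_σ^k·e^{−δ₄₅|x−y|_T}` with the tree's
`delta45 d a L` of `king_lemma45_torus` (the Combes–Thomas rate there is `κ′ ≤ κ_U∕4 ≤ σκ_U`, so the interpolation costs no decay). [cite: King1986, Lemma 4.5 (4.38) p.674] -/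
theorem king_lemma45_torus_sigma_sameRate {a m2 σ : ℝ} (ha : 0 < a) (hm : 0 < m2) (hσ0 : 1 / 4 ≤ σ) (hσ1 : σ ≤ 1)
    {L k n : ℕ} [NeZero L] (hL : 2 ≤ L) (hk : 1 ≤ k) (hn : 1 ≤ n) (M : Fin d → ℕ) [∀ μ, NeZero (M μ)]
    (x y : Tor (fine L M)) :
    |(effLaplacian (L ^ k) (fine L M) (aK a L k) (((L ^ k : ℕ) : ℝ) ^ 2) m2
          + (a * ((L : ℝ) ^ 2)⁻¹) • blockProj L M)⁻¹ x y
      - (effLaplacian (L ^ n * L ^ k) (fine L M) (aK a L (k + n)) (((L ^ n * L ^ k : ℕ) : ℝ) ^ 2) m2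
          + (a * ((L : ℝ) ^ 2)⁻¹) • blockProj L M)⁻¹ x y|
      ≤ K45Sig d a L σ * thetaSig L σ ^ k * Real.exp (-(delta45 d a L * tdistT (fine L M) x y)) := by
  have h := king_lemma45_torus_sigma (d := d) ha hm (lt_of_lt_of_le (by norm_num) hσ0) hσ1 hL hk hn M x y
  rwa [delta45Sig_eq_delta45 ha hL hσ0] at h

/-- **HEADLINE (σ = ¼): (4.38) AT THE RATE `L^{−3k/2}` WITH KING'S DECAY RATE `δ₄₅`** — strictly sharper than the printed `L^{−k}` at no cost in the
decay rate: `|C^{(k)}(x,y) − C^{(k+n)}(x,y)| ≤ K₄₅(¼)·(L^{−3/2})^k·e^{−δ₄₅|x−y|_T}` (`thetaSig L (1/4) = L^{−3/2}`, `thetaSig_quarter`). [cite: King1986, Lemma 4.5 (4.38) p.674] -/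
theorem king_lemma45_torus_threeHalves {a m2 : ℝ} (ha : 0 < a) (hm : 0 < m2)
    {L k n : ℕ} [NeZero L] (hL : 2 ≤ L) (hk : 1 ≤ k) (hn : 1 ≤ n) (M : Fin d → ℕ) [∀ μ, NeZero (M μ)]
    (x y : Tor (fine L M)) :
    |(effLaplacian (L ^ k) (fine L M) (aK a L k) (((L ^ k : ℕ) : ℝ) ^ 2) m2
          + (a * ((L : ℝ) ^ 2)⁻¹) • blockProj L M)⁻¹ x y
      - (effLaplacian (L ^ n * L ^ k) (fine L M) (aK a L (k + n)) (((L ^ n * L ^ k : ℕ) : ℝ) ^ 2) m2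
          + (a * ((L : ℝ) ^ 2)⁻¹) • blockProj L M)⁻¹ x y|
      ≤ K45Sig d a L (1 / 4) * ((L : ℝ) ^ (-(3 / 2 : ℝ))) ^ k
          * Real.exp (-(delta45 d a L * tdistT (fine L M) x y)) := by
  have h := king_lemma45_torus_sigma_sameRate (d := d) ha hm le_rfl (by norm_num) hL hk hn M x y
  rwa [thetaSig_quarter] at h

end Torus

/-! ## §4 By name: the node's unit-layer inequality with `θ = L^{−2(1−σ)}` -/

section ByName

variable {d : ℕ} {L : ℕ} [NeZero L] {a m2 : ℝ}

/-- **LEMMA 4.5 AT AN INDEX, INTERPOLATED RATE** (sides swapped): `|C^{(k+n)}(x,z) − C^{(k)}(x,z)| ≤ K₄₅(σ)·θ_σ^k·e^{−δ₄₅(σ)|x−z|_T}` on the index's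
torus (`d+1` directions; `L ≥ 2`, `a, m² > 0`, `0 < σ ≤ 1`). [cite: King1986, Lemma 4.5 (4.38) p.674] -/
theorem kingKer_abs_le_sigma (ha : 0 < a) (hm : 0 < m2) (hL : 2 ≤ L) {σ : ℝ} (hσ0 : 0 < σ) (hσ1 : σ ≤ 1)
    (i : KingIndex d L) (x z : Tor (kingTor i)) :
    |kingCov L i.Mn a m2 (L ^ i.n * L ^ i.k) (i.k + i.n) x z - kingCov L i.Mn a m2 (L ^ i.k) i.k x z|
      ≤ K45Sig (d + 1) a L σ * thetaSig L σ ^ i.k * Real.exp (-(delta45Sig (d + 1) a L σ * tdistT (kingTor i) x z)) := by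
  rw [abs_sub_comm]
  exact king_lemma45_torus_sigma (d := d + 1) ha hm hσ0 hσ1 hL i.one_le_k i.one_le_n i.Mn x z

/-- **THE UNIT LAYER AT THE INTERPOLATED RATE, BY NAME**: for every index and configuration and every `σ ∈ (0,1]`,
`EtaRateIneqUnit (kingKer i) inΛ tdistT (K₄₅(σ)+1) δ₄₅(σ) θ_σ k` with `θ_σ = L^{−2(1−σ)}` (`σ = ½`, `θ = L⁻¹`: part 5's `etaRateIneqUnit_king`; as `σ ↓ 0`,
`θ_σ ↓ L⁻²` while `δ₄₅(σ) = min(κ′, σκ_U)∕2 ↓ 0`). [cite: King1986, Lemma 4.5 (4.38) p.674; Balaban1985BackgroundPropagators, Thm 3.15 (3.187) p.432 (quantifier template)] -/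
theorem etaRateIneqUnit_king_sigma (ha : 0 < a) (hm : 0 < m2) (hL : 2 ≤ L) {σ : ℝ} (hσ0 : 0 < σ) (hσ1 : σ ≤ 1)
    (i : KingIndex d L) (U : Unit) :
    EtaRateIneqUnit (kingKer a m2 i) (fun _ => True) (kingDist (d := d) (L := L) i)
      (K45Sig (d + 1) a L σ + 1) (delta45Sig (d + 1) a L σ) (thetaSig L σ) (kingInstance (d := d) (L := L) i).gc.k U := by
  intro y y' _ _
  show |kingCov L i.Mn a m2 (L ^ i.n * L ^ i.k) (i.k + i.n) y y' - kingCov L i.Mn a m2 (L ^ i.k) i.k y y'|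
    ≤ (K45Sig (d + 1) a L σ + 1) * Real.exp (-(delta45Sig (d + 1) a L σ * tdistT (kingTor i) y y')) * thetaSig L σ ^ i.k
  have hθ : 0 ≤ thetaSig L σ ^ i.k := pow_nonneg (thetaSig_pos (by omega) σ).le _
  calc _ ≤ K45Sig (d + 1) a L σ * thetaSig L σ ^ i.k * Real.exp (-(delta45Sig (d + 1) a L σ * tdistT (kingTor i) y y')) :=
        kingKer_abs_le_sigma ha hm hL hσ0 hσ1 i y y'
    _ ≤ (K45Sig (d + 1) a L σ + 1) * thetaSig L σ ^ i.k * Real.exp (-(delta45Sig (d + 1) a L σ * tdistT (kingTor i) y y')) := by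
        gcongr; linarith
    _ = _ := by ring

/-- **THE UNIT LAYER AT THE RATE `L^{−3k/2}` WITH KING'S `δ₄₅`, BY NAME** (σ = ¼): `EtaRateIneqUnit (kingKer i) inΛ tdistT (K₄₅(¼)+1) δ₄₅ L^{−3/2} k`.
[cite: King1986, Lemma 4.5 (4.38) p.674] -/
theorem etaRateIneqUnit_king_threeHalves (ha : 0 < a) (hm : 0 < m2) (hL : 2 ≤ L) (i : KingIndex d L) (U : Unit) :
    EtaRateIneqUnit (kingKer a m2 i) (fun _ => True) (kingDist (d := d) (L := L) i)
      (K45Sig (d + 1) a L (1 / 4) + 1) (delta45 (d + 1) a L) ((L : ℝ) ^ (-(3 / 2 : ℝ))) (kingInstance (d := d) (L := L) i).gc.k U := by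
  have h := etaRateIneqUnit_king_sigma (d := d) ha hm hL (σ := 1 / 4) (by norm_num) (by norm_num) i U
  rwa [delta45Sig_eq_delta45 ha hL le_rfl, thetaSig_quarter] at h

end ByName

end Summit.QuantumFields.YangMills.BalabanUVNodes.N15.KingModel

end
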